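/-
Speedrun cell sr-mbsolver — LIT team (lit-1 gen-8), LEAD D-19 r118 (c) default track: lane-B transport for
`relax = mps(N, D, A)` rows ("THEOREM B" of `sr-mbsolver-lit-4/THEOREM-B.md`), PRIMAL form, FERMION case (model
`hubbard_jw(U)` of `FORMAT-ltisdp.md` §4.1: Jordan–Wigner local dimension `4`, charges `(n↑, n↓)` / `q_eff = (2n↑−1, 2n↓−1)`).
HONEST FRAMING: first certified bounds; not a superconductivity verdict; every number certified or labelled float.

WHAT THIS GIVES. For a lane-B `relax = mps(N, D, A)` Hubbard-chain row the two readers certify FORMAT §2 (d): `c·y ≥ E` for every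
`y = (ρ₃, ω₄, …, ω_N)` feasible for the problem. `ksdnClaim_of_mpsClaim` proves the EDGE "mps-claim ⇒ lti(N)-claim": that finite
statement — `ρ₃` carrying VERBATIM the rows of the `lti` node in FORMAT-ltisdp form (`Transport/LTIPrimalHubbardChainKSDN.lean`,
`Rows.LTIChainKSDNNode`) on the three-site window `{-1, 0, 1}` (PSD, trace, LTI `tr_{-1} ρ₃ = tr_{1} ρ₃`, `(N↑, N↓)` sectors, total
density of site `-1`, real, `|·| ≤ 1`), the `ω`-rows E4L/E4R/E_mL/E_mR/PSD/sectors/real/bounds with `W₂ = cgMap A 2`, `L = leftMap A`,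
`R = rightMap A` (`ρ₃` read in the coordinates `i ↦ i − 1`, `Fin 3 ≃ {-1,0,1}`, then as (first two sites, last site) /
(first site, last two)), and the FORMAT bond objective `U n_{-1↑}n_{-1↓} − t Σ_σ (c†_{-1σ}c_{0σ} + h.c.)` — IMPLIES the `hclaim` of
`lti_primal_chainWindow_energyDensity[At]_ge_ksdn` for the `N = n+3`-site window `{-1, …, n+1}`; the thermodynamic limit is then
ONE application away: `lti_primal_chainWindow_energyDensity_ge_ksdn t hU n (ksdnClaim_of_mpsClaim …) : E ≤ hubbardChainEnergyDensity t U`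
(density `1`; `…At…` for density `p/q`), and BY NAME `Rows.MPSChainKSDNNode.ltiChainKSDNNode` (`Rows/HubbardChainMPSNodes.lean`).

PROOF. Let `ρ` be feasible for the `lti(N)` node on `W = {-1,…,n+1}`. (i) Coordinates `e_N : Fin (n+3) ≃ W`, `i ↦ i − 1`
(`exists_finEquiv_chainWindow`) turn `ρ` into `ρ^F := tr_{e_N} ρ ∈ Op (Fin (n+3)) 4` (a relabelling): PSD, trace one, `(N↑,N↓)`-sectored
and real (inherited by any partial trace, `Transport/ChainWindowShift.lean`), and LOCALLY TRANSLATION INVARIANT in the `Fin` sense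
(`tr_L ρ^F = tr_R ρ^F`) because `succ ≫ e_N = e_{N−1} ≫ (shift by 1)` and `castSucc ≫ e_N = e_{N−1} ≫ incl` as embeddings into `W`
(an embedding into a chain window is determined by its coordinates, `polySite_eq_of_coord_eq`). (ii) The model-independent core
`exists_mpsRows_of_window` (`Transport/MPSPrimalWindow.lean`, KSDN §4.2) produces `ω_m = C_{m−2}(ρ^F|_{first m})` with every `ω`-row
relative to `ρ^F|_{first 3}`, the `(N↑,N↓)` sectors being read as the additive charge `q_eff`. (iii) `ρ₃ := tr_{W ∖ {-1,0,1}} ρ`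
satisfies the three-site `lti` rows (shift consistency `spinPartialTrace_eq_of_shift`; sectors, realness, density of site `-1` and the
bond objective on `{-1,0}` transfer along the inclusion of the INITIAL SEGMENT `{-1,0,1}`, where the Jordan–Wigner reading of the CAR
isotony is the spin isotony: `trace_toSpin_mul_spinPartialTrace_incl`), and `ρ^F|_{first 3}` is `ρ₃` read through `e₃`
(`castLE ≫ e_N = e₃ ≫ incl`, `spinPartialTrace_equiv`). [cite: KullEtAl2024, §2.3–2.5, §4.2 eqs. (MPSextension), (relaxLocTIn); §6.2]
[cite: ArakiMoriya2003, §4.1] [cite: EvansKawahigashi1998, §6.5]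
-/
import Summits.Ventures.CertifiedManyBodySolver.Transport.MPSPrimalWindow
import Summits.Ventures.CertifiedManyBodySolver.Transport.LTIPrimalHubbardChainKSDN
import Summits.Ventures.CertifiedManyBodySolver.Transport.LTIPrimalHubbardChainEnt
import HarnessLib

noncomputable section

open Matrix Complex Filter Topology
open scoped ComplexOrder Kronecker BigOperators
open Literature.Probability.LatticeModels
open Literature.MathematicalPhysics.QuantumLattice
open Literature.MathematicalPhysics.QuantumLattice.HubbardWave0
open Literature.MathematicalPhysics.QuantumLattice.ThermodynamicLimit
open Literature.MathematicalPhysics.QuantumLattice.JordanWigner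
open Literature.MathematicalPhysics.QuantumManyBody.StateRelaxation
open Literature.MathematicalPhysics.QuantumLattice.MPSCoarseGraining
open Literature.Computability.QuantumComplexity (traceLeft traceRight)

namespace Summit.Ventures.CertifiedManyBodySolver.Transport

/-! ### Coordinates `i ↦ i − 1` of a chain window `{-1, …, b}` -/

section Coordinates

/-- **Coordinates of a chain window**: for `m = b + 2` there is a bijection `Fin m ≃ {-1, …, b}` with `i ↦ i − 1`.
[folklore] -/
theorem exists_finEquiv_chainWindow (m : ℕ) (b : ℤ) (hb : (m : ℤ) = b + 2) :
    ∃ e : Fin m ≃ PolySite (chainWindow (-1) b), ∀ i, ofLex (e i).1 0 = ((i : ℕ) : ℤ) - 1 := by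
  have hmem : ∀ i : Fin m, (fun _ => ((i : ℕ) : ℤ) - 1 : Site 1) ∈ chainWindow (-1) b := fun i => by
    rw [mem_chainWindow]
    have hi : ((i : ℕ) : ℤ) < m := by exact_mod_cast i.2
    show -1 ≤ ((i : ℕ) : ℤ) - 1 ∧ ((i : ℕ) : ℤ) - 1 ≤ b
    omega
  let f : Fin m → PolySite (chainWindow (-1) b) := fun i => PolySite.pt _ (hmem i)
  have hf : ∀ i, ofLex (f i).1 0 = ((i : ℕ) : ℤ) - 1 := fun i => rfl
  have hinj : Function.Injective f := fun i j hij => by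
    have h := congrArg (fun z : PolySite (chainWindow (-1) b) => ofLex z.1 0) hij
    simp only [hf] at h
    exact Fin.ext (by omega)
  have hsurj : Function.Surjective f := fun y => by
    have hy := mem_chainWindow.1 (PolySite.ofLex_mem y)
    have hlt : (ofLex y.1 0 + 1).toNat < m := by
      have h1 : ((ofLex y.1 0 + 1).toNat : ℤ) = ofLex y.1 0 + 1 := Int.toNat_of_nonneg (by omega)
      omega
    refine ⟨⟨(ofLex y.1 0 + 1).toNat, hlt⟩, polySite_eq_of_coord_eq ?_⟩
    rw [hf]
    have h1 : ((ofLex y.1 0 + 1).toNat : ℤ) = ofLex y.1 0 + 1 := Int.toNat_of_nonneg (by omega)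
    show (((ofLex y.1 0 + 1).toNat : ℕ) : ℤ) - 1 = ofLex y.1 0
    omega
  exact ⟨Equiv.ofBijective f ⟨hinj, hsurj⟩, fun i => hf i⟩

/-- Two embeddings into the sites of a chain window with the same coordinates are equal. [folklore] -/
theorem embedding_eq_of_coord_eq {X : Type*} {W : Finset (Site 1)} {φ ψ : X ↪ PolySite W}
    (h : ∀ x, ofLex (φ x).1 0 = ofLex (ψ x).1 0) : φ = ψ :=
  Function.Embedding.ext fun x => polySite_eq_of_coord_eq (h x)

/-- `{-1, 0} ⊆ {-1, 0, 1}`. [folklore] -/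
theorem chainWindow_zero_subset_one : chainWindow (-1) 0 ⊆ chainWindow (-1) 1 := chainWindow_mono_right (-1) (by norm_num)

/-- `{-1, 0} + 1 = {0, 1} ⊆ {-1, 0, 1}`. [folklore] -/
theorem affShiftSet_chainWindow_zero_subset_one : affShiftSet 1 (unitVec 0) (chainWindow (-1) 0) ⊆ chainWindow (-1) 1 :=
  affShiftSet_chainWindow_subset (-1) 0

/-- `-1 ∈ {-1, 0, 1}`. [folklore] -/
theorem neg_unitVec_mem_chainWindow_one : (-unitVec 0 : Site 1) ∈ chainWindow (-1) 1 :=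
  neg_unitVec_mem_chainWindow (by norm_num)

/-- `0 ∈ {-1, 0, 1}`. [folklore] -/
theorem zero_mem_chainWindow_one : (0 : Site 1) ∈ chainWindow (-1) 1 := zero_mem_chainWindow (by norm_num)

end Coordinates

/-! ### The `(N↑, N↓)` sectors as an additive charge: FORMAT-ltisdp's `q_eff = (2n↑ − 1, 2n↓ − 1)` -/

section Charge

variable {X : Type*} [Fintype X]

/-- If an operator vanishes between configurations with different `N↑` or different `N↓` (the `(N↑, N↓)`-sector zeros of the `lti`
node), then it vanishes between configurations with different total charge `Σ_x q_eff(s_x)`, `q_eff(s) = (2n↑(s) − 1, 2n↓(s) − 1) ∈ ℤ²`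
(FORMAT-ltisdp §4.1 `hubbard_jw`: "q_eff(s) = (2n↑−1, 2n↓−1)"). [cite: KullEtAl2024, §3.3] -/
theorem apply_eq_zero_of_sum_qeff_ne {M : Matrix (TensorIndex X 4) (TensorIndex X 4) ℂ}
    (hsec : ∀ σ : Fin 2, ∀ k k' : TensorIndex X 4,
      (∑ x, if σ ∈ siteOcc (k x) then 1 else 0 : ℕ) ≠ (∑ x, if σ ∈ siteOcc (k' x) then 1 else 0 : ℕ) → M k k' = 0)
    (u v : TensorIndex X 4)
    (huv : (∑ x, (fun s : Fin 4 => ((2 * (if (0 : Fin 2) ∈ siteOcc s then 1 else 0 : ℤ) - 1,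
        2 * (if (1 : Fin 2) ∈ siteOcc s then 1 else 0 : ℤ) - 1) : ℤ × ℤ)) (u x)) ≠
      (∑ x, (fun s : Fin 4 => ((2 * (if (0 : Fin 2) ∈ siteOcc s then 1 else 0 : ℤ) - 1,
        2 * (if (1 : Fin 2) ∈ siteOcc s then 1 else 0 : ℤ) - 1) : ℤ × ℤ)) (v x))) : M u v = 0 := by
  classical
  by_contra hne
  have hcount : ∀ σ : Fin 2, (∑ x, if σ ∈ siteOcc (u x) then 1 else 0 : ℕ) = (∑ x, if σ ∈ siteOcc (v x) then 1 else 0 : ℕ) :=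
    fun σ => by
      by_contra h
      exact hne (hsec σ u v h)
  have key : ∀ σ : Fin 2, (∑ x, (2 * (if σ ∈ siteOcc (u x) then 1 else 0 : ℤ) - 1)) =
      ∑ x, (2 * (if σ ∈ siteOcc (v x) then 1 else 0 : ℤ) - 1) := by
    intro σ
    have h' : (∑ x, (if σ ∈ siteOcc (u x) then 1 else 0 : ℤ)) = ∑ x, (if σ ∈ siteOcc (v x) then 1 else 0 : ℤ) := by
      have := hcount σ
      exact_mod_cast this
    simp only [Finset.sum_sub_distrib, ← Finset.mul_sum, h']
  apply huv
  refine Prod.ext ?_ ?_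
  · rw [Prod.fst_sum, Prod.fst_sum]
    exact key 0
  · rw [Prod.snd_sum, Prod.snd_sum]
    exact key 1

end Charge

/-! ### THEOREM B, fermion case: the `mps(N, D, A)` statement implies the `lti(N)` statement (FORMAT-ltisdp form) -/

section Transport

variable {β : Type*} [Fintype β] [DecidableEq β]

/-- **THEOREM B, fermion case (edge form): the primal `mps(N, D, A)` statement for `hubbard_jw(U)` implies the primal `lti(N)`
statement in FORMAT-ltisdp form.** Data: window `N = n+3 ≥ 4` sites; a REAL MPS tensor `A = (A^s)_{s ∈ Fin 4}` on the bond index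
type `β`, CHARGE COVARIANT for `q_eff = (2n↑−1, 2n↓−1)` with bond charges `qb : β → ℤ × ℤ` (FORMAT §4.12 "CHECKED at generation");
a-priori bounds `B_m ≥ 0` with `‖T^{m−2}‖_F² ≤ B_m²`; the coordinates `e₃ : Fin 3 ≃ {-1,0,1}`, `i ↦ i − 1`. HYPOTHESIS `hclaim` =
the by-value node of a `hubbard_jw` `mps` row: over `ρ₃ : Op (PolySite {-1,0,1}) 4` and `ω₄, …, ω_N` — `ρ₃ ⪰ 0`, `tr ρ₃ = 1`, LTI
`tr_{-1} ρ₃ = tr_{1} ρ₃`, `(N↑,N↓)`-sector zeros, total density of site `-1` equal to `ν`, real entries, `|ρ₃| ≤ 1` (VERBATIM the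
`lti` node's rows on the three-site window); E4L/E4R with `ρ₃` read through `e₃` then as (first two, last) / (first, last two);
E_mL/E_mR (`m = k+5 ≤ N`); `ω_m ⪰ 0`, `cgTag q_eff qb` sectors, real, `|ω_m| ≤ B_m` (`m = k+4 ≤ N`); conclusion
`E ≤ Re tr(toSpin(U n_{-1↑}n_{-1↓} − t Σ_σ (c†_{-1σ}c_{0σ} + c†_{0σ}c_{-1σ})) ρ₃)`. CONCLUSION: the `hclaim` of
`lti_primal_chainWindow_energyDensity[At]_ge_ksdn` on `{-1, …, n+1}` with density `ν`.
[cite: KullEtAl2024, §2.3–2.5, §4.2, §6.2] [cite: ArakiMoriya2003, §4.1] -/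
theorem ksdnClaim_of_mpsClaim (t U : ℝ) (n : ℕ) (hn : 1 ≤ n) (A : Fin 4 → Matrix β β ℂ)
    (hAreal : ∀ s a b, star (A s a b) = A s a b) (qb : β → ℤ × ℤ)
    (hAcov : ∀ s a b, A s a b ≠ 0 → qb b = qb a +
      (fun s : Fin 4 => ((2 * (if (0 : Fin 2) ∈ siteOcc s then 1 else 0 : ℤ) - 1,
        2 * (if (1 : Fin 2) ∈ siteOcc s then 1 else 0 : ℤ) - 1) : ℤ × ℤ)) s)
    (B : ℕ → ℝ) (hB : ∀ k, k + 4 ≤ n + 3 → 0 ≤ B (k + 4) ∧ frobSq (transferOp A ^ (k + 2)) ≤ B (k + 4) ^ 2)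
    (e₃ : Fin 3 ≃ PolySite (chainWindow (-1) 1)) (he₃ : ∀ i, ofLex (e₃ i).1 0 = ((i : ℕ) : ℤ) - 1)
    {ν E : ℝ}
    (hclaim : ∀ (ρ₃ : Op (PolySite (chainWindow (-1) 1)) 4)
        (ω : ℕ → Matrix (Fin 4 × ((β × β) × Fin 4)) (Fin 4 × ((β × β) × Fin 4)) ℂ),
      ρ₃.PosSemidef → ρ₃.trace = 1 →
      spinPartialTrace ((PolySite.affEmb 1 (unitVec 0) (chainWindow (-1) 0)).trans
          (PolySite.incl affShiftSet_chainWindow_zero_subset_one)) ρ₃ =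
        spinPartialTrace (PolySite.incl chainWindow_zero_subset_one) ρ₃ →
      (∀ σ : Fin 2, ∀ k k' : TensorIndex (PolySite (chainWindow (-1) 1)) 4,
        (∑ x, if σ ∈ siteOcc (k x) then 1 else 0 : ℕ) ≠ (∑ x, if σ ∈ siteOcc (k' x) then 1 else 0 : ℕ) → ρ₃ k k' = 0) →
      ((toSpin (nAt (-unitVec 0) neg_unitVec_mem_chainWindow_one 0 +
          nAt (-unitVec 0) neg_unitVec_mem_chainWindow_one 1) * ρ₃).trace).re = ν →
      (∀ k k' : TensorIndex (PolySite (chainWindow (-1) 1)) 4, starRingEnd ℂ (ρ₃ k k') = ρ₃ k k') →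
      (∀ k k' : TensorIndex (PolySite (chainWindow (-1) 1)) 4, ‖ρ₃ k k'‖ ≤ 1) →
      traceLeft (ω 4) = (cgMap A 2 ⊗ₖ (1 : Matrix (Fin 4) (Fin 4) ℂ)) *
          (ρ₃.submatrix (Equiv.arrowCongr e₃ (Equiv.refl (Fin 4))) (Equiv.arrowCongr e₃ (Equiv.refl (Fin 4)))).submatrix
            ((Equiv.prodComm _ _).trans (Fin.snocEquiv fun _ => Fin 4))
            ((Equiv.prodComm _ _).trans (Fin.snocEquiv fun _ => Fin 4)) *
        (cgMap A 2 ⊗ₖ (1 : Matrix (Fin 4) (Fin 4) ℂ))ᴴ →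
      traceRight ((ω 4).submatrix (Equiv.prodAssoc _ _ _) (Equiv.prodAssoc _ _ _)) =
        ((1 : Matrix (Fin 4) (Fin 4) ℂ) ⊗ₖ cgMap A 2) *
          (ρ₃.submatrix (Equiv.arrowCongr e₃ (Equiv.refl (Fin 4))) (Equiv.arrowCongr e₃ (Equiv.refl (Fin 4)))).submatrix
            (Fin.consEquiv fun _ => Fin 4) (Fin.consEquiv fun _ => Fin 4) *
        ((1 : Matrix (Fin 4) (Fin 4) ℂ) ⊗ₖ cgMap A 2)ᴴ →
      (∀ k, k + 5 ≤ n + 3 → traceLeft (ω (k + 5)) =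
        (leftMap A ⊗ₖ (1 : Matrix (Fin 4) (Fin 4) ℂ)) *
          (ω (k + 4)).submatrix (Equiv.prodAssoc _ _ _) (Equiv.prodAssoc _ _ _) *
        (leftMap A ⊗ₖ (1 : Matrix (Fin 4) (Fin 4) ℂ))ᴴ) →
      (∀ k, k + 5 ≤ n + 3 → traceRight ((ω (k + 5)).submatrix (Equiv.prodAssoc _ _ _) (Equiv.prodAssoc _ _ _)) =
        ((1 : Matrix (Fin 4) (Fin 4) ℂ) ⊗ₖ rightMap A) * ω (k + 4) *
        ((1 : Matrix (Fin 4) (Fin 4) ℂ) ⊗ₖ rightMap A)ᴴ) →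
      (∀ k, k + 4 ≤ n + 3 → (ω (k + 4)).PosSemidef) →
      (∀ k, k + 4 ≤ n + 3 → ∀ i j,
        cgTag (fun s : Fin 4 => ((2 * (if (0 : Fin 2) ∈ siteOcc s then 1 else 0 : ℤ) - 1,
          2 * (if (1 : Fin 2) ∈ siteOcc s then 1 else 0 : ℤ) - 1) : ℤ × ℤ)) qb i ≠
        cgTag (fun s : Fin 4 => ((2 * (if (0 : Fin 2) ∈ siteOcc s then 1 else 0 : ℤ) - 1,
          2 * (if (1 : Fin 2) ∈ siteOcc s then 1 else 0 : ℤ) - 1) : ℤ × ℤ)) qb j → ω (k + 4) i j = 0) →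
      (∀ k, k + 4 ≤ n + 3 → ∀ i j, starRingEnd ℂ (ω (k + 4) i j) = ω (k + 4) i j) →
      (∀ k, k + 4 ≤ n + 3 → ∀ i j, ‖ω (k + 4) i j‖ ≤ B (k + 4)) →
      E ≤ ((toSpin ((U : ℂ) • (nAt (-unitVec 0) neg_unitVec_mem_chainWindow_one 0 *
            nAt (-unitVec 0) neg_unitVec_mem_chainWindow_one 1) +
          (-(t : ℂ)) • ∑ σ : Fin 2,
            ((cAt (-unitVec 0) neg_unitVec_mem_chainWindow_one σ)ᴴ *
                cAt 0 zero_mem_chainWindow_one σ +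
              (cAt 0 zero_mem_chainWindow_one σ)ᴴ *
                cAt (-unitVec 0) neg_unitVec_mem_chainWindow_one σ)) * ρ₃).trace).re) :
    ∀ ρ : Op (PolySite (chainWindow (-1) ((n : ℤ) + 1))) 4, ρ.PosSemidef → ρ.trace = 1 →
      spinPartialTrace ((PolySite.affEmb 1 (unitVec 0) (chainWindow (-1) (n : ℤ))).trans
          (PolySite.incl (affShiftSet_chainWindow_subset (-1) (n : ℤ)))) ρ =
        spinPartialTrace (PolySite.incl (chainWindow_mono_right (-1) (by omega : (n : ℤ) ≤ n + 1))) ρ →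
      (∀ σ : Fin 2, ∀ k k' : TensorIndex (PolySite (chainWindow (-1) ((n : ℤ) + 1))) 4,
        (∑ x, if σ ∈ siteOcc (k x) then 1 else 0 : ℕ) ≠ (∑ x, if σ ∈ siteOcc (k' x) then 1 else 0 : ℕ) → ρ k k' = 0) →
      ((toSpin (nAt (-unitVec 0) (neg_unitVec_mem_chainWindow (by omega : (-1 : ℤ) ≤ n + 1)) 0 +
          nAt (-unitVec 0) (neg_unitVec_mem_chainWindow (by omega : (-1 : ℤ) ≤ n + 1)) 1) * ρ).trace).re = ν →
      (∀ k k' : TensorIndex (PolySite (chainWindow (-1) ((n : ℤ) + 1))) 4, starRingEnd ℂ (ρ k k') = ρ k k') →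
      (∀ k k' : TensorIndex (PolySite (chainWindow (-1) ((n : ℤ) + 1))) 4, ‖ρ k k'‖ ≤ 1) →
      E ≤ ((toSpin ((U : ℂ) • (nAt (-unitVec 0) (neg_unitVec_mem_chainWindow (by omega : (-1 : ℤ) ≤ n + 1)) 0 *
            nAt (-unitVec 0) (neg_unitVec_mem_chainWindow (by omega : (-1 : ℤ) ≤ n + 1)) 1) +
          (-(t : ℂ)) • ∑ σ : Fin 2,
            ((cAt (-unitVec 0) (neg_unitVec_mem_chainWindow (by omega : (-1 : ℤ) ≤ n + 1)) σ)ᴴ *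
                cAt 0 (zero_mem_chainWindow (by omega : (0 : ℤ) ≤ n + 1)) σ +
              (cAt 0 (zero_mem_chainWindow (by omega : (0 : ℤ) ≤ n + 1)) σ)ᴴ *
                cAt (-unitVec 0) (neg_unitVec_mem_chainWindow (by omega : (-1 : ℤ) ≤ n + 1)) σ)) * ρ).trace).re := by
  intro ρ hpsd htr hLTI hsec hdens hreal _hbd
  classical
  -- the windows `W₃ = {-1,0,1} ⊆ W = {-1,…,n+1}` and the shifts of the LTI embeddings
  have hW3 : chainWindow (-1) 1 ⊆ chainWindow (-1) ((n : ℤ) + 1) := chainWindow_mono_right (-1) (by omega)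
  have hlow3 : IsLowerSet (Set.range (PolySite.incl hW3)) := isLowerSet_range_incl_chainWindow hW3
  have hφ₀ := shift_incl (chainWindow_mono_right (-1) (by omega : (n : ℤ) ≤ n + 1))
  have hφ₁ : ∀ y, ofLex (((PolySite.affEmb 1 (unitVec 0) (chainWindow (-1) (n : ℤ))).trans
      (PolySite.incl (affShiftSet_chainWindow_subset (-1) (n : ℤ)))) y).1 0 = ofLex y.1 0 + 1 := fun y => by
    rw [shift_affEmb_trans_incl, chain_unitVec_apply_zero]
  have hρstar : ∀ u v, star (ρ u v) = ρ u v := fun u v => by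
    have := hreal u v
    rwa [starRingEnd_apply] at this
  -- (i) coordinates and the relabelled window variable `ρ^F`
  obtain ⟨eN, heN⟩ := exists_finEquiv_chainWindow (n + 3) ((n : ℤ) + 1) (by push_cast; ring)
  obtain ⟨e', he'⟩ := exists_finEquiv_chainWindow (n + 2) (n : ℤ) (by push_cast; ring)
  set ρF : Op (Fin (n + 3)) 4 := spinPartialTrace eN.toEmbedding ρ with hρFdef
  have hFpsd : ρF.PosSemidef := posSemidef_spinPartialTrace _ hpsd
  have hFtr : ρF.trace = 1 := by rw [hρFdef, trace_spinPartialTrace, htr]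
  have hsucc : (Fin.succEmb (n + 2)).trans eN.toEmbedding =
      e'.toEmbedding.trans ((PolySite.affEmb 1 (unitVec 0) (chainWindow (-1) (n : ℤ))).trans
        (PolySite.incl (affShiftSet_chainWindow_subset (-1) (n : ℤ)))) := by
    refine embedding_eq_of_coord_eq fun i => ?_
    rw [Function.Embedding.trans_apply, Function.Embedding.trans_apply, Equiv.coe_toEmbedding, Equiv.coe_toEmbedding, heN,
      hφ₁, he', Fin.coe_succEmb, Fin.val_succ]
    push_cast
    ring
  have hcast : (Fin.castSuccEmb : Fin (n + 2) ↪ Fin (n + 3)).trans eN.toEmbedding =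
      e'.toEmbedding.trans (PolySite.incl (chainWindow_mono_right (-1) (by omega : (n : ℤ) ≤ n + 1))) := by
    refine embedding_eq_of_coord_eq fun i => ?_
    rw [Function.Embedding.trans_apply, Function.Embedding.trans_apply, Equiv.coe_toEmbedding, Equiv.coe_toEmbedding, heN,
      hφ₀, he', Fin.coe_castSuccEmb, Fin.val_castSucc, add_zero]
  have hFLTI : spinPartialTrace (Fin.succEmb (n + 2)) ρF = spinPartialTrace Fin.castSuccEmb ρF := by
    rw [hρFdef, ← spinPartialTrace_trans, ← spinPartialTrace_trans, hsucc, hcast, spinPartialTrace_trans e'.toEmbedding,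
      spinPartialTrace_trans e'.toEmbedding, hLTI]
  have hFsecσ : ∀ σ : Fin 2, ∀ k k' : TensorIndex (Fin (n + 3)) 4,
      (∑ x, if σ ∈ siteOcc (k x) then 1 else 0 : ℕ) ≠ (∑ x, if σ ∈ siteOcc (k' x) then 1 else 0 : ℕ) → ρF k k' = 0 :=
    fun σ k k' h => spinPartialTrace_apply_eq_zero_of_sector eN.toEmbedding σ (hsec σ) h
  have hFsec : ∀ u v : TensorIndex (Fin (n + 3)) 4,
      (∑ x, (fun s : Fin 4 => ((2 * (if (0 : Fin 2) ∈ siteOcc s then 1 else 0 : ℤ) - 1,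
          2 * (if (1 : Fin 2) ∈ siteOcc s then 1 else 0 : ℤ) - 1) : ℤ × ℤ)) (u x)) ≠
        (∑ x, (fun s : Fin 4 => ((2 * (if (0 : Fin 2) ∈ siteOcc s then 1 else 0 : ℤ) - 1,
          2 * (if (1 : Fin 2) ∈ siteOcc s then 1 else 0 : ℤ) - 1) : ℤ × ℤ)) (v x)) → ρF u v = 0 :=
    fun u v huv => apply_eq_zero_of_sum_qeff_ne hFsecσ u v huv
  have hFstar : ∀ u v, star (ρF u v) = ρF u v := fun u v => by
    have := conj_spinPartialTrace_apply eN.toEmbedding hreal u v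
    rwa [starRingEnd_apply] at this
  -- (ii) the model-independent core: KSDN's `ω_m = C_{m−2}(ρ^F|_{first m})`
  obtain ⟨ω, hE4L, hE4R, hEmL, hEmR, hωpsd, hωsec, hωreal, hωbd⟩ :=
    exists_mpsRows_of_window (n + 1) (by omega) A hAreal _ qb hAcov B hB ρF hFpsd hFtr hFLTI hFsec hFstar
  -- (iii) the three-site marginal `ρ₃` and its rows
  set ρ₃ : Op (PolySite (chainWindow (-1) 1)) 4 := spinPartialTrace (PolySite.incl hW3) ρ with hρ₃def
  have h3psd : ρ₃.PosSemidef := posSemidef_spinPartialTrace _ hpsd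
  have h3tr : ρ₃.trace = 1 := by rw [hρ₃def, trace_spinPartialTrace, htr]
  have h3LTI : spinPartialTrace ((PolySite.affEmb 1 (unitVec 0) (chainWindow (-1) 0)).trans
        (PolySite.incl affShiftSet_chainWindow_zero_subset_one)) ρ₃ =
      spinPartialTrace (PolySite.incl chainWindow_zero_subset_one) ρ₃ := by
    rw [hρ₃def, ← spinPartialTrace_trans, ← spinPartialTrace_trans]
    refine spinPartialTrace_eq_of_shift hφ₀ hφ₁ hLTI 1 ?_ ?_
    · intro y
      rw [shift_trans (shift_affEmb_trans_incl (unitVec (0 : Fin 1)) affShiftSet_chainWindow_zero_subset_one)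
        (shift_incl hW3), chain_unitVec_apply_zero]
      push_cast
      ring
    · intro y
      rw [shift_trans (shift_incl chainWindow_zero_subset_one) (shift_incl hW3), add_zero]
  have h3sec : ∀ σ : Fin 2, ∀ k k' : TensorIndex (PolySite (chainWindow (-1) 1)) 4,
      (∑ x, if σ ∈ siteOcc (k x) then 1 else 0 : ℕ) ≠ (∑ x, if σ ∈ siteOcc (k' x) then 1 else 0 : ℕ) → ρ₃ k k' = 0 :=
    fun σ k k' h => spinPartialTrace_apply_eq_zero_of_sector (PolySite.incl hW3) σ (hsec σ) h
  have h3dens : ((toSpin (nAt (-unitVec 0) neg_unitVec_mem_chainWindow_one 0 +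
      nAt (-unitVec 0) neg_unitVec_mem_chainWindow_one 1) * ρ₃).trace).re = ν := by
    rw [hρ₃def, trace_toSpin_mul_spinPartialTrace_incl hW3 hlow3, fermionEmbed_add, fermionEmbed_incl_nAt,
      fermionEmbed_incl_nAt]
    exact hdens
  have h3real : ∀ k k' : TensorIndex (PolySite (chainWindow (-1) 1)) 4, starRingEnd ℂ (ρ₃ k k') = ρ₃ k k' :=
    fun k k' => conj_spinPartialTrace_apply (PolySite.incl hW3) hreal k k'
  have h3bd : ∀ k k' : TensorIndex (PolySite (chainWindow (-1) 1)) 4, ‖ρ₃ k k'‖ ≤ 1 :=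
    norm_apply_le_one_of_posSemidef h3psd h3tr
  -- `ρ^F|_{first 3}` is `ρ₃` read through `e₃`
  have hemb : (Fin.castLEEmb (show 3 ≤ n + 3 by omega)).trans eN.toEmbedding =
      e₃.toEmbedding.trans (PolySite.incl hW3) := by
    refine embedding_eq_of_coord_eq fun i => ?_
    rw [Function.Embedding.trans_apply, Function.Embedding.trans_apply, Equiv.coe_toEmbedding, Equiv.coe_toEmbedding, heN,
      Fin.castLEEmb_apply, Fin.val_castLE]
    change _ = ofLex (e₃ i).1 0
    rw [he₃]
  have hlink : headMarginal (show 3 ≤ n + 1 + 2 by omega) ρF =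
      ρ₃.submatrix (Equiv.arrowCongr e₃ (Equiv.refl (Fin 4))) (Equiv.arrowCongr e₃ (Equiv.refl (Fin 4))) := by
    rw [headMarginal, hρFdef, ← spinPartialTrace_trans, hemb, spinPartialTrace_trans, spinPartialTrace_equiv]
    ext u v
    rw [reindexOp_apply, Matrix.submatrix_apply]
    rfl
  rw [hlink] at hE4L hE4R
  -- (iv) apply the `mps` claim and move the objective back to the big window
  have hE := hclaim ρ₃ ω h3psd h3tr h3LTI h3sec h3dens h3real h3bd hE4L hE4R hEmL hEmR hωpsd hωsec hωreal hωbd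
  rw [hρ₃def, trace_toSpin_mul_spinPartialTrace_incl hW3 hlow3] at hE
  simp only [fermionEmbed_add, fermionEmbed_smul, fermionEmbed_sum, fermionEmbed_mul, fermionEmbed_conjTranspose,
    fermionEmbed_incl_nAt, fermionEmbed_incl_cAt] at hE
  exact hE

end Transport

end Summit.Ventures.CertifiedManyBodySolver.Transport
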